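import Literature.Combinatorics.Enumerative.PermanentProductForm
import HarnessLib

/-!
# The Laplace expansion of a permanent along a set of rows

Topic `Literature/Combinatorics/Enumerative`.  For a square matrix `A = (A i j)` over a
commutative semiring, indexed by a finite type `ι`, and ANY set `P ⊆ ι` of rows,

  `per A = ∑_{J ⊆ ι, |J| = |P|} per A[P, J] · per A[Pᶜ, Jᶜ]`,

the sum running over the column sets `J` of the same size as `P`, `A[P, J]` denoting the
`|P| × |J|` submatrix on rows `P` and columns `J` (Minc, *Permanents*, Ch. 2, Thm. 1.2, the
"Laplace expansion for permanents"; for `|P| = 1` it is the row expansion).  Unlike the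
determinant, no signs appear.

Since Mathlib's `Matrix.permanent` is only defined for matrices indexed by ONE type on both
sides, the minors `per A[P, J]` are written as the sign-free bijection sums
`∑_{b : P ≃ J} ∏_{p ∈ P} A p (b p)` (`Equiv` between the coerced finsets), and separately
identified with honest permanents of `Fin k`-indexed submatrices for any enumerations of `P` and
`J` (`sum_equiv_prod_eq_permanent_submatrix`).  Main statements:

* `Literature.Combinatorics.Enumerative.permanent_eq_sum_powersetCard_mul` — the expansion along
  the rows `P : Finset ι`, minors as bijection sums;
* `Literature.Combinatorics.Enumerative.sum_equiv_prod_eq_permanent_submatrix` — a bijection sum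
  IS the permanent of the submatrix `A.submatrix eP eJ` for enumerations `eP : Fin k ≃ P`,
  `eJ : Fin k ≃ J`;
* `Literature.Combinatorics.Enumerative.permanent_submatrix_equiv_equiv` — reindexing rows and
  columns by (possibly different) equivalences does not change the permanent.

Proof: write `per A = ∑_σ ∏_i A i (σ i)` (`sum_perm_prod_apply_eq_permanent`), sort the
permutations `σ` by the image `J = σ(P)` (`Finset.sum_fiberwise_of_maps_to`), split each product
over `P ⊔ Pᶜ`, and identify `{σ | σ(P) = J}` with `(P ≃ J) × (Pᶜ ≃ Jᶜ)` by restriction /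
gluing (`Finset.sum_bij'`).  Everything is over an arbitrary `CommSemiring` and an arbitrary
finite index type with decidable equality; no new definitions.

## References

* [Minc1978] H. Minc, *Permanents*, Encyclopedia of Mathematics and its Applications 6,
  Addison-Wesley 1978, Ch. 2 §2.1, Thm. 1.2 (Laplace expansion theorem for permanents).
-/

namespace Literature.Combinatorics.Enumerative

open Finset Matrix

variable {ι : Type*} {R : Type*} [CommSemiring R]

/-! ### Reindexing -/

/-- Reindexing the rows and the columns of a square matrix by two (possibly different)
equivalences does not change the permanent (Minc, *Permanents*, Ch. 2 §2.1: the permanent is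
invariant under permutations of rows and of columns). [cite: Minc1978, Ch. 2, §2.1] -/
theorem permanent_submatrix_equiv_equiv [Fintype ι] [DecidableEq ι] {κ : Type*} [Fintype κ]
    [DecidableEq κ] (A : Matrix ι ι R) (e f : κ ≃ ι) :
    (A.submatrix e f).permanent = A.permanent := by
  unfold Matrix.permanent
  -- `σ ↦ e ∘ σ ∘ f⁻¹`
  refine Fintype.sum_equiv
    ⟨fun σ => (f.symm.trans σ).trans e, fun τ => (f.trans τ).trans e.symm,
      fun σ => ?_, fun τ => ?_⟩ _ _ fun σ => ?_
  · ext i; simp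
  · ext i; simp
  · refine Fintype.prod_equiv f _ _ fun i => ?_
    simp [Matrix.submatrix_apply]

/-! ### Bijection sums are permanents of submatrices -/

/-- For enumerations `eP : Fin k ≃ P`, `eJ : Fin k ≃ J` of two `k`-sets of indices, the sign-free
bijection sum `∑_{b : P ≃ J} ∏_{p ∈ P} A p (b p)` is the permanent of the `k × k` submatrix of `A`
on rows `P` and columns `J` (in the given enumerations; by `permanent_submatrix_equiv_equiv` the
choice of enumerations is immaterial). [cite: Minc1978, Ch. 2, §2.1] -/
theorem sum_equiv_prod_eq_permanent_submatrix [DecidableEq ι] (A : Matrix ι ι R)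
    (P J : Finset ι) {k : ℕ}
    (eP : Fin k ≃ ↥P) (eJ : Fin k ≃ ↥J) :
    ∑ b : ↥P ≃ ↥J, ∏ p : ↥P, A p (b p) =
      (A.submatrix (fun i => (eP i : ι)) (fun j => (eJ j : ι))).permanent := by
  unfold Matrix.permanent
  symm
  -- `σ ↦ b := eP⁻¹ ≫ σ⁻¹ ≫ eJ`, so that `b (eP (σ i)) = eJ i`.
  refine Fintype.sum_equiv
    ⟨fun σ => eP.symm.trans (σ.symm.trans eJ), fun b => (eP.trans (b.trans eJ.symm)).symm,
      fun σ => ?_, fun b => ?_⟩ _ _ fun σ => ?_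
  · ext i; simp
  · ext p; simp
  · -- reindex the product along `i ↦ eP (σ i)`
    refine Fintype.prod_equiv (σ.trans eP) _ _ fun i => ?_
    simp [Matrix.submatrix_apply]

/-! ### Restricting and gluing permutations -/

section Glue

variable {P J : Finset ι}

/-- If `σ(P) = J` then `σ p ∈ J` for `p ∈ P`. [folklore] -/
private theorem mem_of_map_eq {σ : Equiv.Perm ι} (h : P.map σ.toEmbedding = J) {p : ι}
    (hp : p ∈ P) : σ p ∈ J := by
  rw [← h]; exact Finset.mem_map_of_mem _ hp

/-- If `σ(P) = J` then `σ⁻¹ j ∈ P` for `j ∈ J`. [folklore] -/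
private theorem symm_mem_of_map_eq {σ : Equiv.Perm ι} (h : P.map σ.toEmbedding = J) {j : ι}
    (hj : j ∈ J) : σ.symm j ∈ P := by
  rw [← h, Finset.mem_map] at hj
  obtain ⟨p, hp, rfl⟩ := hj
  simpa using hp

/-- If `σ(P) = J` then `σ i ∈ J ↔ i ∈ P`. [folklore] -/
private theorem mem_iff_of_map_eq {σ : Equiv.Perm ι} (h : P.map σ.toEmbedding = J) (i : ι) :
    σ i ∈ J ↔ i ∈ P := by
  refine ⟨fun hi => ?_, mem_of_map_eq h⟩
  simpa using symm_mem_of_map_eq h hi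

end Glue

/-! ### The Laplace expansion -/

/-- **Laplace expansion of the permanent along the rows `P`** (Minc, *Permanents*, Ch. 2,
Thm. 1.2): for every square matrix `A` over a commutative semiring and every set of rows `P`,
`per A = ∑_{|J| = |P|} per A[P, J] · per A[Pᶜ, Jᶜ]`, the minors written as sign-free bijection sums
(see `sum_equiv_prod_eq_permanent_submatrix` for their identification with permanents of
submatrices). [cite: Minc1978, Ch. 2, Thm. 1.2] -/
theorem permanent_eq_sum_powersetCard_mul [Fintype ι] [DecidableEq ι] (A : Matrix ι ι R)
    (P : Finset ι) :
    A.permanent =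
      ∑ J ∈ (Finset.univ : Finset ι).powersetCard P.card,
        (∑ b : ↥P ≃ ↥J, ∏ p : ↥P, A p (b p)) *
          (∑ b' : ↥(Pᶜ) ≃ ↥(Jᶜ), ∏ p : ↥(Pᶜ), A p (b' p)) := by
  classical
  rw [← sum_perm_prod_apply_eq_permanent]
  -- sort the permutations by the image of `P`
  have hmaps : ∀ σ ∈ (Finset.univ : Finset (Equiv.Perm ι)),
      P.map σ.toEmbedding ∈ (Finset.univ : Finset ι).powersetCard P.card := fun σ _ => by
    rw [Finset.mem_powersetCard]; exact ⟨Finset.subset_univ _, Finset.card_map _⟩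
  rw [← Finset.sum_fiberwise_of_maps_to hmaps]
  refine Finset.sum_congr rfl fun J _ => ?_
  -- gluing a bijection `P ≃ J` and a bijection `Pᶜ ≃ Jᶜ` into a permutation of `ι`
  let cP : ↥(Pᶜ) ≃ {i // ¬ i ∈ P} := Equiv.subtypeEquivRight fun i => Finset.mem_compl
  let cJ : ↥(Jᶜ) ≃ {j // ¬ j ∈ J} := Equiv.subtypeEquivRight fun j => Finset.mem_compl
  let glue : (↥P ≃ ↥J) × (↥(Pᶜ) ≃ ↥(Jᶜ)) → Equiv.Perm ι := fun bb =>
    (Equiv.sumCompl (· ∈ P)).symm.trans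
      ((bb.1.sumCongr (cP.symm.trans (bb.2.trans cJ))).trans (Equiv.sumCompl (· ∈ J)))
  have glue_mem : ∀ (bb : (↥P ≃ ↥J) × (↥(Pᶜ) ≃ ↥(Jᶜ))) {i : ι} (h : i ∈ P),
      glue bb i = (bb.1 ⟨i, h⟩ : ι) := fun bb i h => by
    simp [glue, Equiv.sumCompl_symm_apply_of_pos h]
  have glue_not : ∀ (bb : (↥P ≃ ↥J) × (↥(Pᶜ) ≃ ↥(Jᶜ))) {i : ι} (h : i ∉ P),
      glue bb i = (bb.2 ⟨i, Finset.mem_compl.mpr h⟩ : ι) := fun bb i h => by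
    simp [glue, Equiv.sumCompl_symm_apply_of_neg h, cP, cJ]
    rfl
  have glue_map : ∀ bb : (↥P ≃ ↥J) × (↥(Pᶜ) ≃ ↥(Jᶜ)), P.map (glue bb).toEmbedding = J := by
    intro bb
    ext j
    simp only [Finset.mem_map, Equiv.coe_toEmbedding]
    constructor
    · rintro ⟨p, hp, rfl⟩
      rw [glue_mem bb hp]; exact (bb.1 ⟨p, hp⟩).2
    · intro hj
      refine ⟨(bb.1.symm ⟨j, hj⟩ : ι), (bb.1.symm ⟨j, hj⟩).2, ?_⟩
      rw [glue_mem bb (bb.1.symm ⟨j, hj⟩).2]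
      simp
  -- split each product over `P ⊔ Pᶜ` and pass to pairs of bijections
  rw [Finset.sum_mul_sum, ← Finset.sum_product']
  symm
  refine Finset.sum_bij' (fun bb _ => glue bb)
    (fun σ hσ =>
      (σ.subtypeEquiv fun i => (mem_iff_of_map_eq (Finset.mem_filter.mp hσ).2 i).symm,
        σ.subtypeEquiv fun i => by
          rw [Finset.mem_compl, Finset.mem_compl, mem_iff_of_map_eq (Finset.mem_filter.mp hσ).2 i]))
    ?_ ?_ ?_ ?_ ?_
  · -- the glued permutation lies in the fibre of `J`
    intro bb _
    exact Finset.mem_filter.mpr ⟨Finset.mem_univ _, glue_map bb⟩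
  · intro σ _; simp
  · -- restrict ∘ glue = id
    rintro ⟨b, b'⟩ _
    refine Prod.ext ?_ ?_
    · ext p; simp only [Equiv.subtypeEquiv_apply]; rw [glue_mem (b, b') p.2]
    · ext p; simp only [Equiv.subtypeEquiv_apply]
      rw [glue_not (b, b') (Finset.mem_compl.mp p.2)]
  · -- glue ∘ restrict = id
    intro σ hσ
    ext i
    by_cases hi : i ∈ P
    · rw [glue_mem _ hi]; simp
    · rw [glue_not _ hi]; simp
  · -- the summands agree
    rintro ⟨b, b'⟩ _
    rw [← Finset.prod_mul_prod_compl P, ← Finset.prod_coe_sort P, ← Finset.prod_coe_sort Pᶜ]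
    congr 1
    · exact Fintype.prod_congr _ _ fun p => by rw [glue_mem (b, b') p.2]
    · exact Fintype.prod_congr _ _ fun p => by rw [glue_not (b, b') (Finset.mem_compl.mp p.2)]

end Literature.Combinatorics.Enumerative
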